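import Summits.QuantumFields.YangMills.Theorems.BalabanUVNodesN13WilsonPartitionFnGaugeFixedLowerBound

/-!
# BalabanUVNodes ∕ N13 — THE SEQUENTIAL FADDEEV–POPOV STEP: gauging away one more target-disjoint layer whose targets avoid what is already constrained
# (engine of the layered axial gauge of `…N13GaugeFixingAxialLayers` and of its sharp Gaussian lower bound on Bałaban's Wilson `Z`)

(Track A, DAG node N13 = [B16]; cluster K1 — K1⁹ `StabilityBRunRowsAtRecordR13SepCoPHV` = stmt-QuantumFields-27364, helper; seat `pub-ymgap-dag-n13-w3` g5; 2026-08-28; count-neutral.)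
Sharpening of this seat's F19∕F20 (p634656 ∕ p635238): the even-`x₀` MATCHING gauged away `|T|∕2` bonds at once (coefficient `(d−½)(N²−1)∕2`); here the whole family
`{⟨x, e₀⟩ : x₀ ≠ n−1}` of direction-`0` bonds that do not wrap around the torus (`n = 2L^{m+K−j}` sites per direction) is gauged away LAYER BY LAYER (`x₀ = 0, 1, …, n−2`): each layer is
target-disjoint, and its targets (`x₀ = t+1`) avoid every endpoint of the layers below, so the Faddeev–Popov identity of F19 — re-proved in §1 under invariance ONLY for gauge transformations
supported on the layer's targets — applies to `F·Π_{below} 1_B`.  Result (§4): `haar(B)^{|T|(1−1∕n)}·Z = ∫ e^{−βA}·Π_{x₀≠n−1} 1_B(U⟨x,e₀⟩) dU`, whence (§5) for `G = SU(N)`, `β ≥ 1`: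
`log Z_P(β) ≥ −((d−1) + 1∕n)·|T₁^{(0)}|·((N²−1)∕2·log β + C_N) − 8d²·|T₁^{(0)}|` — the `log β` coefficient `(3∕2 + 1∕(2n))(N²−1)` at `d = 4` is print's Gaussian count `(3∕2)d(𝔤)`
([Balaban1988Convergent] (1.15): `d(𝔤)` per integrated TRANSVERSAL bond) up to `1∕(2n) → 0` along the continuum runs.  Consumed by the companion
`…N13NormalisationSlopeThresholdAtRecord13SepCoPHV`: the no-go of p636072 extends from coupling-blind inputs to every normalisation whose coupling SLOPE is below print's `d(𝔤)∕4` (up to `O(L⁻⁴)`).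

WHAT IS PROVED HERE ([folklore] measure theory; 0 `sorry`, 0 `def`; first of two files, split for the 400-line lint): §1 `pow_mul_integral_eq_integral_mul_prod_indicator_of_invariantOnTargets`
(F19's identity with the weaker invariance); §2 `prod_indicator_gaugeAct_eq_of_eq_one` (indicator products do not see gauge transformations trivial at their endpoints); §3 ★
`pow_mul_integral_eq_of_layer` (the sequential step).  The companion `…N13GaugeFixingAxialLayers` does the direction-0 layers, the count and the `Z` bound.
HONEST FRAMING: elementary; nothing of Bałaban's asserted or refuted; no skeleton ∕ route text touched; N13 NOT discharged; K1⁹ NEITHER proved NOR refuted; counts UNMOVED (typed 28∕28 ·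
discharged 5∕27 · A 5∕28); R4 closes the conditional finite-𝕋⁴ rung `BalabanLadder.UV` only — the Yang–Mills mass gap (Clay) is NOT proved by any of this; nothing continuum ∕ ℝ⁴ ∕ OS.
No `sorry`, `def`, `instance`, `notation`.
-/

noncomputable section

open MeasureTheory
open scoped BigOperators

namespace Summit.QuantumFields.YangMills.BalabanUVNodes.N13GaugeFixingSequentialLayer

open Literature.MathematicalPhysics.QuantumFieldTheory.Balaban1983to89
open Missing
open Summit.QuantumFields.YangMills.BalabanUVNodes.N13GaugeFixingTargetDisjointBondFamily (integral_indicator_mul_left_eq_haarReal gaugeInvariant_boltzmann)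
open Summit.QuantumFields.YangMills.BalabanUVNodes.N13WilsonPartitionFnGaugeFixedLowerBound (card_plaq_le log_haarReal_suOpBall_ge wilsonAction4_le_of_bondBall)

/-! ## §1. The Faddeev–Popov identity under invariance supported on the targets only -/

section FaddeevPopov

variable {P : Params} {j : ℕ} {G : Type*} [GaugeGroup G] [MeasurableSpace G] [HaarData G] [MeasurableMul₂ G]

/-- **F19's Faddeev–Popov identity for a target-disjoint bond family, with `F` invariant ONLY under the gauge transformations supported on the family's targets** (`u y = 1` off `tgt(M)`):
`haar(B)^{|M|}·∫F dU = ∫F·Π_{b∈M}1_B(U b) dU`.  Same proof (the Faddeev–Popov transformation `h_u` IS supported on `tgt(M)`). [cite: Balaban1987RG1, (0.15)–(0.16) pp.254–255] -/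
theorem pow_mul_integral_eq_integral_mul_prod_indicator_of_invariantOnTargets (M : Finset (PBond P j))
    (hsrc : ∀ b ∈ M, ∀ b' ∈ M, b'.tgt ≠ b.src) (hinj : Set.InjOn PBond.tgt (M : Set (PBond P j)))
    {B : Set G} (hB : MeasurableSet B) {F : GaugeField P j G → ℝ}
    (hF : ∀ u : GaugeTransf P j G, (∀ y, (∀ b ∈ M, b.tgt ≠ y) → u y = 1) → ∀ U, F (GaugeField.gaugeAct u U) = F U)
    (hFi : Integrable F (fieldMeasure P j G)) :
    (HaarData.haar : Measure G).real B ^ M.card * ∫ U, F U ∂(fieldMeasure P j G) =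
      ∫ U, F U * ∏ b ∈ M, B.indicator (fun _ => (1 : ℝ)) (U b) ∂(fieldMeasure P j G) := by
  classical
  set c : ℝ := (HaarData.haar : Measure G).real B with hc
  set η : Measure (M → G) := Measure.pi fun _ => (HaarData.haar : Measure G) with hη
  set Φ : GaugeField P j G → (M → G) → ℝ := fun U u => F U * ∏ b : M, B.indicator (fun _ => (1 : ℝ)) (U b * u b) with hΦ
  have h1 : ∀ U : GaugeField P j G, ∫ u, (∏ b : M, B.indicator (fun _ => (1 : ℝ)) (U b * u b)) ∂η = c ^ M.card := by
    intro U
    rw [hη, integral_fintype_prod_eq_prod (fun (b : M) (w : G) => B.indicator (fun _ => (1 : ℝ)) (U b * w))]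
    simp_rw [integral_indicator_mul_left_eq_haarReal hB]
    rw [Finset.prod_const, Finset.card_univ, Fintype.card_coe]
  have h2 : c ^ M.card * ∫ U, F U ∂(fieldMeasure P j G) = ∫ U, ∫ u, Φ U u ∂η ∂(fieldMeasure P j G) := by
    rw [← integral_const_mul]
    refine integral_congr_ae (Filter.Eventually.of_forall fun U => ?_)
    simp only [hΦ]
    rw [integral_const_mul, h1 U, mul_comm]
  have hΦ_int : Integrable (Function.uncurry Φ) ((fieldMeasure P j G).prod η) := by
    have ha : Integrable (fun p : GaugeField P j G × (M → G) => F p.1) ((fieldMeasure P j G).prod η) := hFi.comp_fst η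
    have hb_meas : Measurable (fun p : GaugeField P j G × (M → G) => ∏ b : M, B.indicator (fun _ => (1 : ℝ)) (p.1 b * p.2 b)) := by
      refine Finset.measurable_prod _ fun b _ => ?_
      have hm1 : Measurable fun p : GaugeField P j G × (M → G) => p.1 (b : PBond P j) :=
        (measurable_pi_apply (b : PBond P j)).comp measurable_fst
      have hm2 : Measurable fun p : GaugeField P j G × (M → G) => p.2 b := (measurable_pi_apply b).comp measurable_snd
      exact (measurable_const.indicator hB).comp (hm1.mul hm2)
    have hb_bdd : ∀ p : GaugeField P j G × (M → G), ‖∏ b : M, B.indicator (fun _ => (1 : ℝ)) (p.1 b * p.2 b)‖ ≤ 1 := by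
      intro p
      rw [Real.norm_eq_abs, Finset.abs_prod]
      refine Finset.prod_le_one (fun b _ => abs_nonneg _) fun b _ => ?_
      rw [abs_of_nonneg (Set.indicator_nonneg (fun _ _ => zero_le_one) _)]
      exact Set.indicator_le_self' (fun _ _ => zero_le_one) _
    have h := ha.bdd_mul hb_meas.aestronglyMeasurable (Filter.Eventually.of_forall hb_bdd)
    refine h.congr (Filter.Eventually.of_forall fun p => ?_)
    simp only [hΦ, Function.uncurry]
    ring
  rw [h2, integral_integral_swap hΦ_int]
  have h4 : ∀ u : M → G, ∫ U, Φ U u ∂(fieldMeasure P j G) = ∫ U, F U * ∏ b ∈ M, B.indicator (fun _ => (1 : ℝ)) (U b) ∂(fieldMeasure P j G) := by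
    intro u
    let hu : GaugeTransf P j G := fun y => if hy : ∃ b, b ∈ M ∧ PBond.tgt b = y then (u ⟨Classical.choose hy, (Classical.choose_spec hy).1⟩)⁻¹ else 1
    have hsupp : ∀ y, (∀ b ∈ M, b.tgt ≠ y) → hu y = 1 := by
      intro y hy
      have hne : ¬ ∃ b, b ∈ M ∧ PBond.tgt b = y := fun ⟨b, hb, he⟩ => hy b hb he
      simp only [hu, dif_neg hne]
    have hsrc1 : ∀ b ∈ M, hu b.src = 1 := fun b hb => hsupp b.src fun b' hb' he => hsrc b hb b' hb' he
    have htgt1 : ∀ (b : PBond P j) (hb : b ∈ M), hu b.tgt = (u ⟨b, hb⟩)⁻¹ := by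
      intro b hb
      have hex : ∃ b', b' ∈ M ∧ PBond.tgt b' = b.tgt := ⟨b, hb, rfl⟩
      simp only [hu, dif_pos hex]
      have hb' : Classical.choose hex = b := hinj (Classical.choose_spec hex).1 hb (Classical.choose_spec hex).2
      congr 2
      exact Subtype.ext hb'
    have hact : ∀ (U : GaugeField P j G) (b : PBond P j) (hb : b ∈ M), GaugeField.gaugeAct hu U b = U b * u ⟨b, hb⟩ := by
      intro U b hb
      simp only [GaugeField.gaugeAct, hsrc1 b hb, htgt1 b hb, one_mul, inv_inv]
    have hpt : ∀ U : GaugeField P j G, Φ U u =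
        (fun W : GaugeField P j G => F W * ∏ b ∈ M, B.indicator (fun _ => (1 : ℝ)) (W b)) (GaugeField.gaugeAct hu U) := by
      intro U
      simp only [hΦ]
      rw [hF hu hsupp U, ← Finset.prod_coe_sort M]
      congr 1
      exact Finset.prod_congr rfl fun b _ => by rw [hact U b b.2]
    simp_rw [hpt]
    exact B12FaddeevPopov016.integral_comp_gaugeAct hu (fun W : GaugeField P j G => F W * ∏ b ∈ M, B.indicator (fun _ => (1 : ℝ)) (W b))
  simp_rw [h4]
  rw [integral_const, hη]
  simp

/-! ## §2–§3. The sequential step: add a target-disjoint layer whose targets avoid the endpoints of what is already constrained -/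

omit [MeasurableSpace G] [HaarData G] [MeasurableMul₂ G] in
/-- An indicator product over a bond set `S` does not see a gauge transformation which is trivial at every endpoint of `S`. [folklore] -/
theorem prod_indicator_gaugeAct_eq_of_eq_one (S : Finset (PBond P j)) (B : Set G) (u : GaugeTransf P j G)
    (hu : ∀ b ∈ S, u b.src = 1 ∧ u b.tgt = 1) (U : GaugeField P j G) :
    ∏ b ∈ S, B.indicator (fun _ => (1 : ℝ)) (GaugeField.gaugeAct u U b) = ∏ b ∈ S, B.indicator (fun _ => (1 : ℝ)) (U b) :=
  Finset.prod_congr rfl fun b hb => by simp only [GaugeField.gaugeAct, (hu b hb).1, (hu b hb).2, one_mul, inv_one, mul_one]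

/-- **THE SEQUENTIAL STEP.**  If the `S`-constrained identity `haar(B)^{|S|}·∫F = ∫F·Π_S 1_B` holds for a gauge-invariant integrable `F`, and `M` is a target-disjoint, `tgt`-injective layer
DISJOINT from `S` whose targets are endpoints of NO bond of `S`, then `haar(B)^{|S|+|M|}·∫F = ∫F·Π_{S∪M} 1_B` (§1 applied to `F·Π_S 1_B`, invariant under transformations supported on `tgt(M)` by §2).
[cite: Balaban1987RG1, (0.15)–(0.16) pp.254–255 (bookkeeping)] -/
theorem pow_mul_integral_eq_of_layer [DecidableEq (PBond P j)] (S M : Finset (PBond P j)) (hSM : Disjoint S M)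
    (hsrc : ∀ b ∈ M, ∀ b' ∈ M, b'.tgt ≠ b.src) (hinj : Set.InjOn PBond.tgt (M : Set (PBond P j)))
    (havoid : ∀ b ∈ M, ∀ b' ∈ S, b.tgt ≠ b'.src ∧ b.tgt ≠ b'.tgt)
    {B : Set G} (hB : MeasurableSet B) {F : GaugeField P j G → ℝ} (hF : GaugeField.GaugeInvariant F)
    (hFi : Integrable F (fieldMeasure P j G))
    (hS : (HaarData.haar : Measure G).real B ^ S.card * ∫ U, F U ∂(fieldMeasure P j G) =
      ∫ U, F U * ∏ b ∈ S, B.indicator (fun _ => (1 : ℝ)) (U b) ∂(fieldMeasure P j G)) :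
    (HaarData.haar : Measure G).real B ^ (S.card + M.card) * ∫ U, F U ∂(fieldMeasure P j G) =
      ∫ U, F U * ∏ b ∈ S ∪ M, B.indicator (fun _ => (1 : ℝ)) (U b) ∂(fieldMeasure P j G) := by
  classical
  set c : ℝ := (HaarData.haar : Measure G).real B with hc
  -- the `S`-constrained weight `G_S := F·Π_S 1_B`
  set GS : GaugeField P j G → ℝ := fun U => F U * ∏ b ∈ S, B.indicator (fun _ => (1 : ℝ)) (U b) with hGS
  have hprod_meas : Measurable fun U : GaugeField P j G => ∏ b ∈ S, B.indicator (fun _ => (1 : ℝ)) (U b) :=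
    Finset.measurable_prod _ fun b _ => (measurable_const.indicator hB).comp (measurable_pi_apply b)
  have hprod_bdd : ∀ U : GaugeField P j G, ‖∏ b ∈ S, B.indicator (fun _ => (1 : ℝ)) (U b)‖ ≤ 1 := by
    intro U
    rw [Real.norm_eq_abs, Finset.abs_prod]
    refine Finset.prod_le_one (fun b _ => abs_nonneg _) fun b _ => ?_
    rw [abs_of_nonneg (Set.indicator_nonneg (fun _ _ => zero_le_one) _)]
    exact Set.indicator_le_self' (fun _ _ => zero_le_one) _
  have hGSi : Integrable GS (fieldMeasure P j G) := by
    have h := hFi.bdd_mul hprod_meas.aestronglyMeasurable (Filter.Eventually.of_forall hprod_bdd)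
    refine h.congr (Filter.Eventually.of_forall fun U => ?_)
    simp only [hGS]; ring
  -- `G_S` is invariant under the transformations supported on `tgt(M)`
  have hGSinv : ∀ u : GaugeTransf P j G, (∀ y, (∀ b ∈ M, b.tgt ≠ y) → u y = 1) → ∀ U, GS (GaugeField.gaugeAct u U) = GS U := by
    intro u hu U
    simp only [hGS]
    rw [hF u U, prod_indicator_gaugeAct_eq_of_eq_one S B u (fun b' hb' => ⟨hu _ fun b hb => (havoid b hb b' hb').1, hu _ fun b hb => (havoid b hb b' hb').2⟩) U]
  have hstep := pow_mul_integral_eq_integral_mul_prod_indicator_of_invariantOnTargets M hsrc hinj hB hGSinv hGSi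
  -- assemble
  rw [pow_add, mul_comm (c ^ S.card), mul_assoc, hS]
  show c ^ M.card * ∫ U, GS U ∂(fieldMeasure P j G) = _
  rw [hstep]
  refine integral_congr_ae (Filter.Eventually.of_forall fun U => ?_)
  simp only [hGS]
  rw [Finset.prod_union hSM, mul_assoc]

end FaddeevPopov

end Summit.QuantumFields.YangMills.BalabanUVNodes.N13GaugeFixingSequentialLayer

end
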